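import Summits.RiemannHypothesis.RiemannHypothesis.Theorems.Splittings.ScrewKreinDiscreteCount

/-!
# Screw index transfer, discrete Kreĭn core (5a/4+3): the exponential-sum functional and the symbol of the difference operator

rh-split-screw-bridge g7, lane (xii-d) continuation «EXACT INDEX», file 5a (cut of `xiid/g7/ScrewExactIndexG7.lean` §12–§13;
imports file 4 `ScrewKreinDiscreteCount`).

* `El w` : the exponential-sum functional `E_w(x) = Σ_t x(t) e^{wt}` on point-mass vectors `ℝ →₀ ℂ` as a linear map (`expSum x w = El w x`);
  `El_U` (translation multiplies by `e^{wa}`), `El_SDOp` / `El_aeval` : `E_w ∘ P(SDOp η) = P(σ_η(w)) · E_w` with the SYMBOL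
  `sig η w = σ_η(w) = (2iη)⁻¹ (e^{ηw} − e^{−ηw})`; `sig_neg_conj : σ_η(−w̄) = conj σ_η(w)`, `sig_zero : σ_η(0) = 0`.
* `sig_injOn_ball`, `sig_ne_zero_of_ne_zero` : for `0 < η`, `ηR' < 1`, `σ_η` is injective and zero-free on `0 < ‖w‖ ≤ R'`
  (`z − 1/z = z′ − 1/z′ ⟹ z = z′ ∨ zz′ = −1`, both settled by `|η(w ∓ w′)| < 2 < 2π`).

Classification tags: [folklore] = standard analysis/algebra; [new-combination] = assembled here.
HONEST LABEL: SPLITTING SEARCH over kernel-typed RH-EQUIVALENCES; the exact index theorem relates two OPEN tail data (the screw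
negative index and the number of distinct off-line zeros) and decides neither; nothing here bears on the truth of RH.
-/

noncomputable section

set_option linter.dupNamespace false

namespace Summit.RiemannHypothesis.RiemannHypothesis.Theorems.Splittings.ScrewKreinDiscrete

open Finset Complex MeasureTheory Set Filter Topology Polynomial Module
open scoped ComplexConjugate Matrix
open Literature.NumberTheory.LFunctions
open Literature.Analysis.OperatorTheory
open Literature.Analysis.OperatorTheory.KreinStewart
open Summit.RiemannHypothesis.RiemannHypothesis.Theses.RuelleBand
open Summit.RiemannHypothesis.RiemannHypothesis.Theorems.IntegerScrew
open Summit.RiemannHypothesis.RiemannHypothesis.Theorems.Splittings.ScrewKreinCore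
open Summit.RiemannHypothesis.RiemannHypothesis.Theorems.Splittings.ScrewIndexTransferKrein

/-! ## §12 The exponential-sum functional `E_w` and the symbol of the difference operator -/

/-- The exponential-sum functional `E_w(x) = Σ_t x(t) e^{wt}` as a linear map. -/
def El (w : ℂ) : (ℝ →₀ ℂ) →ₗ[ℂ] ℂ :=
  Finsupp.linearCombination ℂ fun t : ℝ => cexp (w * (t : ℂ))

/-- `E_w(x)` as the finite sum `Σ_{t ∈ supp x} x(t) e^{wt}`. -/
theorem El_apply (w : ℂ) (x : ℝ →₀ ℂ) : El w x = ∑ t ∈ x.support, x t * cexp (w * t) := by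
  rw [El, Finsupp.linearCombination_apply, Finsupp.sum]
  simp only [smul_eq_mul]

/-- `E_w` of a point mass: `E_w(c·δ_s) = c e^{ws}`. -/
theorem El_single (w : ℂ) (s : ℝ) (c : ℂ) : El w (Finsupp.single s c) = c * cexp (w * s) := by
  rw [El, Finsupp.linearCombination_single, smul_eq_mul]

/-- Translation multiplies `E_w` by `e^{wa}`. [folklore] -/
theorem El_U (w : ℂ) (a : ℝ) (x : ℝ →₀ ℂ) : El w (U a x) = cexp (w * a) * El w x := by
  induction x using Finsupp.induction_linear with
  | zero => simp
  | add x y hx hy => rw [map_add, map_add, map_add, hx, hy, mul_add]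
  | single s c =>
    rw [U_single, El_single, El_single]
    push_cast
    rw [mul_add, Complex.exp_add]
    ring

/-- The symbol of `SDOp η`: `σ_η(w) = (2iη)⁻¹ (e^{ηw} − e^{−ηw}) = sinh(ηw)/(iη)`. -/
def sig (η : ℝ) (w : ℂ) : ℂ := ((2 : ℂ) * Complex.I * η)⁻¹ * (cexp (η * w) - cexp (-(η * w)))

/-- `E_w ∘ SDOp η = σ_η(w) · E_w`. [folklore] -/
theorem El_SDOp (w : ℂ) (η : ℝ) (x : ℝ →₀ ℂ) : El w (SDOp η x) = sig η w * El w x := by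
  rw [SDOp_apply, map_smul, map_sub, El_U, El_U, smul_eq_mul, sig]
  push_cast
  ring_nf

/-- `E_w ∘ (SDOp η)^j = σ_η(w)^j · E_w`. [folklore] -/
theorem El_SDOp_pow (w : ℂ) (η : ℝ) (j : ℕ) (x : ℝ →₀ ℂ) :
    El w ((SDOp η ^ j) x) = sig η w ^ j * El w x := by
  induction j generalizing x with
  | zero => simp
  | succ j ih => rw [pow_succ, Module.End.mul_apply, ih, El_SDOp, pow_succ]; ring

/-- `E_w (P(SDOp η) x) = P(σ_η(w)) · E_w x`. [folklore] -/
theorem El_aeval (w : ℂ) (η : ℝ) (P : ℂ[X]) (x : ℝ →₀ ℂ) :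
    El w (aeval (SDOp η : Module.End ℂ (ℝ →₀ ℂ)) P x) = P.eval (sig η w) * El w x := by
  rw [aeval_eq_sum_range, LinearMap.sum_apply, map_sum, Polynomial.eval_eq_sum_range, Finset.sum_mul]
  refine Finset.sum_congr rfl fun j _ => ?_
  rw [LinearMap.smul_apply, map_smul, El_SDOp_pow, smul_eq_mul, mul_assoc]

/-- `σ_η(−w̄) = conj σ_η(w)`. [folklore] -/
theorem sig_neg_conj (η : ℝ) (w : ℂ) : sig η (-conj w) = conj (sig η w) := by
  rw [sig, sig, map_mul, map_sub, ← Complex.exp_conj, ← Complex.exp_conj, map_neg, map_mul,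
    Complex.conj_ofReal, map_inv₀, map_mul, map_mul, Complex.conj_ofReal, Complex.conj_I]
  have h2 : conj (2 : ℂ) = 2 := by norm_num [map_ofNat]
  rw [h2]
  rw [show (η : ℂ) * -conj w = -(η * conj w) by ring, neg_neg]
  have hI : ((2 : ℂ) * -Complex.I * η)⁻¹ = -((2 : ℂ) * Complex.I * η)⁻¹ := by
    rw [show (2 : ℂ) * -Complex.I * η = -((2 : ℂ) * Complex.I * η) by ring, inv_neg]
  rw [hI]
  ring

/-- `σ_η(0) = 0`. -/
theorem sig_zero (η : ℝ) : sig η 0 = 0 := by simp [sig]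

/-! ## §13 One small step: `σ_η` is injective and zero-free on the ball of radius `R' < 1/η` -/

/-- A complex number of norm `< 2π` which is an integer multiple of `2πi` is zero. [folklore] -/
theorem eq_zero_of_norm_lt_two_pi {u : ℂ} {n : ℤ} (hu : u = n * (2 * Real.pi * Complex.I)) (hn : ‖u‖ < 2 * Real.pi) :
    u = 0 := by
  by_cases hn0 : n = 0
  · rw [hu, hn0]; simp
  · exfalso
    have h2 : 2 * Real.pi ≤ ‖(n : ℂ) * (2 * Real.pi * Complex.I)‖ := by
      rw [norm_mul, norm_mul, norm_mul, Complex.norm_I, mul_one, Complex.norm_intCast, Complex.norm_real,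
        Real.norm_eq_abs, abs_of_pos Real.pi_pos, Complex.norm_two]
      have habs : (1 : ℝ) ≤ |(n : ℝ)| := by exact_mod_cast Int.one_le_abs hn0
      nlinarith [Real.pi_gt_three]
    rw [← hu] at h2
    linarith

/-- `w ↦ e^{ηw}` is injective on `‖w‖ ≤ R'` when `ηR' < 1` (then `|η(w − w′)| < 2 < 2π`). [folklore] -/
theorem exp_injOn_ball {η R' : ℝ} (hη : 0 < η) (hηR : η * R' < 1) {w w' : ℂ} (hw : ‖w‖ ≤ R') (hw' : ‖w'‖ ≤ R')
    (h : cexp (η * w) = cexp (η * w')) : w = w' := by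
  obtain ⟨n, hn⟩ := Complex.exp_eq_exp_iff_exists_int.mp h
  have hdiff : (η : ℂ) * (w - w') = n * (2 * Real.pi * Complex.I) := by linear_combination hn
  have hnorm : ‖(η : ℂ) * (w - w')‖ < 2 * Real.pi := by
    rw [norm_mul, Complex.norm_real, Real.norm_eq_abs, abs_of_pos hη]
    have hsub : ‖w - w'‖ ≤ 2 * R' := (norm_sub_le _ _).trans (by linarith)
    calc η * ‖w - w'‖ ≤ η * (2 * R') := mul_le_mul_of_nonneg_left hsub hη.le
      _ < 2 := by nlinarith
      _ < 2 * Real.pi := by linarith [Real.pi_gt_three]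
  have h0 := eq_zero_of_norm_lt_two_pi hdiff hnorm
  rw [mul_eq_zero, sub_eq_zero] at h0
  exact h0.resolve_left (by exact_mod_cast hη.ne')

/-- `e^{η(w + w′)} ≠ −1` on `‖w‖, ‖w′‖ ≤ R'` when `ηR' < 1` (else `2η(w + w′) ∈ 2πiℤ ∖ {0}` has norm `≥ 2π > 4`). [folklore] -/
theorem exp_add_ne_neg_one {η R' : ℝ} (hη : 0 < η) (hηR : η * R' < 1) {w w' : ℂ} (hw : ‖w‖ ≤ R') (hw' : ‖w'‖ ≤ R') :
    cexp (η * (w + w')) ≠ -1 := by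
  intro h
  have hsq : cexp (2 * (η * (w + w'))) = 1 := by
    rw [two_mul, Complex.exp_add, h]; norm_num
  obtain ⟨n, hn⟩ := Complex.exp_eq_one_iff.mp hsq
  have hnorm : ‖(2 : ℂ) * (η * (w + w'))‖ < 2 * Real.pi := by
    rw [norm_mul, Complex.norm_two, norm_mul, Complex.norm_real, Real.norm_eq_abs, abs_of_pos hη]
    have hadd : ‖w + w'‖ ≤ 2 * R' := (norm_add_le _ _).trans (by linarith)
    calc 2 * (η * ‖w + w'‖) ≤ 2 * (η * (2 * R')) := by gcongr
      _ < 4 := by nlinarith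
      _ < 2 * Real.pi := by linarith [Real.pi_gt_three]
  have h0 := eq_zero_of_norm_lt_two_pi hn hnorm
  have h00 : (η : ℂ) * (w + w') = 0 := by
    rcases mul_eq_zero.mp h0 with h2 | h2
    · norm_num at h2
    · exact h2
  rw [h00, Complex.exp_zero] at h
  norm_num at h

/-- The constant `(2iη)⁻¹` is non-zero. -/
theorem coeffC_ne_zero {η : ℝ} (hη : η ≠ 0) : ((2 : ℂ) * Complex.I * η)⁻¹ ≠ 0 := by
  refine inv_ne_zero (mul_ne_zero (mul_ne_zero two_ne_zero Complex.I_ne_zero) ?_)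
  exact_mod_cast hη

/-- **Injectivity of the symbol on a small ball**: `σ_η(w) = σ_η(w′)`, `‖w‖, ‖w′‖ ≤ R' < 1/η` ⟹ `w = w′`
(`z − 1/z = z′ − 1/z′` ⟹ `z = z′` or `zz′ = −1`). [folklore] -/
theorem sig_injOn_ball {η R' : ℝ} (hη : 0 < η) (hηR : η * R' < 1) {w w' : ℂ} (hw : ‖w‖ ≤ R') (hw' : ‖w'‖ ≤ R')
    (h : sig η w = sig η w') : w = w' := by
  rw [sig, sig] at h
  have h1 := mul_left_cancel₀ (coeffC_ne_zero hη.ne') h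
  set z : ℂ := cexp (η * w) with hz
  set z' : ℂ := cexp (η * w') with hz'
  have hz0 : z ≠ 0 := Complex.exp_ne_zero _
  have hz0' : z' ≠ 0 := Complex.exp_ne_zero _
  rw [Complex.exp_neg, Complex.exp_neg] at h1
  -- `(z − z′)(z z′ + 1) = 0`
  have h2 : (z - z') * (z * z' + 1) = 0 := by
    have h3 : (z - z⁻¹ - (z' - z'⁻¹)) * (z * z') = 0 := by rw [h1, sub_self, zero_mul]
    have h4 : (z - z⁻¹ - (z' - z'⁻¹)) * (z * z') = (z - z') * (z * z' + 1) := by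
      field_simp
      ring
    rw [h4] at h3
    exact h3
  rcases mul_eq_zero.mp h2 with h3 | h3
  · exact exp_injOn_ball hη hηR hw hw' (sub_eq_zero.mp h3)
  · exfalso
    have h4 : cexp (η * (w + w')) = -1 := by
      rw [mul_add, Complex.exp_add, ← hz, ← hz']
      linear_combination h3
    exact exp_add_ne_neg_one hη hηR hw hw' h4

/-- **No small non-zero `w` has `σ_η(w) = 0`**. [folklore] -/
theorem sig_ne_zero_of_ne_zero {η R' : ℝ} (hη : 0 < η) (hηR : η * R' < 1) {w : ℂ} (hw : ‖w‖ ≤ R') (hw0 : w ≠ 0) :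
    sig η w ≠ 0 := by
  intro h
  have h0 : sig η (0 : ℂ) = sig η w := by rw [h, sig_zero]
  have hR0 : (0 : ℝ) ≤ R' := (norm_nonneg w).trans hw
  exact hw0 (sig_injOn_ball hη hηR (by simp [hR0]) hw h0).symm

end Summit.RiemannHypothesis.RiemannHypothesis.Theorems.Splittings.ScrewKreinDiscrete
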